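import Literature.MathematicalPhysics.QuantumLattice.HubbardSquareTorusLimitState
import Literature.MathematicalPhysics.QuantumLattice.HubbardWindowCertificateD4
import Summits.Ventures.CertifiedManyBodySolver.Statement
import HarnessLib

/-!
# NGW window nodes with affine-`D₄` rows and ground-state stability rows; split gluing (hubbard-alg L2, H1-STATEMENT.md §3 R2/R3)

HONEST FRAMING (pub-hubbard): ladder R1–R4 with certified numbers; no claim on H/H₀.
HONEST FRAMING (sr-mbsolver / hubbard-alg): first certified bounds; not a superconductivity verdict; every number
certified or labelled float.  This file contains NO number and NO certificate.

WHAT THIS FILE IS.  The Lean STATEMENT asked for by hubbard-alg PLAN v1 §6 L2 ("gluing theorem H1/G1: Lean statement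
filed by 08-24") in the part that is NOT already in the tree: D2 LEAD RULING r157 (e) named the pub-hubbard Lean lane
as the pen (LEAN FILING REQUEST #232); the author of the mathematics is the sr-mbsolver `l2-idea-1` lineage
(`hubbard-alg/L2-cluster/H1-STATEMENT.md`, sha256 `662607649437ac5c…`, 2026-08-22), whose elaborating sketch
`L2-cluster/lean-l2-idea-1/L2SplitSketch.lean` (sha256 `694fcfc34184c3af…`, `lean check` rc 0, 0 sorries) is
reproduced here declaration for declaration, re-namespaced for the Venture tree; PLACEMENT `HubbardAlg/` next to
`TargetWindow.lean` by sr-mbsolver D2 LEAD RULING r158 (a) (2026-08-22T06:52Z).  H1/G1 themselves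
(`LTIRectNode.tiStateNode`, `ltiRectNode_of_andersonCluster_subset`) are op-07's `RectMarginalNodes.lean`
(sha256 `b7b18754ae1e5299…`), filed separately by the sr-mbsolver LIT lineage; the 1-D precedent
`Rows/AndersonDominatedByLTI{,Nodes}.lean` is in the tree.

CONTENTS.
* R3 (PROVED here): `GSObsNode t U n W O lo` — the torus-limit ground-state-class node of
  `le_energyDensity2D_of_forall_torusLimit` with a GENERAL window observable `O`; `GSObsNode.mono`, `GSObsNode.add`,
  `GSObsNode.le_energyDensity2D`, and the split-gluing edges `energyDensity2D_ge_of_split{,₂}` (M7: a podium leg for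
  `H - O` and window legs for `O` add up to a lower bound on `energyDensity2D t U n`).
* R2 (STATEMENT ONLY — the one open theorem): `WindowLTI'` (translation rows; a verbatim re-typing of op-07's
  `WindowLTI`, to be unified by `Iff.rfl` once `RectMarginalNodes` lands), `WindowD4` (affine-`D₄` "iso" rows via the
  tree's `PolySite.d4Emb` / `d4ShiftSet`, [cite: Han2020Bootstrap, §3]), `stabilityObs'` (op-07's Bratteli–Robinson
  stability observable, re-typed), `GSWindowNode t U n W H lo` (ALL row families: positivity, unit trace, translation,
  affine-`D₄`, density, `S^z = 0`, ground-state stability; objective `H`), `IsEnergyObs`, and the residual soundness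
  statement `GSWindowNodeSound t U n W H : Prop` (NOT proved here; proof route in its docstring; kill object of PLAN §6
  L2 by 2026-08-27).  `le_energyDensity2D_of_sound` and the M3 cell `m3EnergyLowerRow_of_sound` consume it BY NAME.
Nothing here is a Literature fact; no internally-minted statement is cited as published.
-/

noncomputable section

namespace Summit.Ventures.CertifiedManyBodySolver.HubbardAlg.GSWindowNodeD4

open Matrix Finset _root_.Filter
open Literature.Probability.LatticeModels
open Literature.MathematicalPhysics.QuantumLattice
open Literature.MathematicalPhysics.QuantumLattice.HubbardWave0
open Literature.MathematicalPhysics.QuantumLattice.ThermodynamicLimit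
open scoped _root_.Topology ComplexOrder

/-- The torus-limit ground-state-class node with a general window observable `O` on the window `W`: every
translation-invariant, even torus limit `ω` of unit `(⌊n L²⌋∧even, S^z = 0)`-sector ground states of the `L × L`
Hubbard tori, of density `n` and spin densities `n/2`, satisfies `lo ≤ Re ω(O)`.  (The hypothesis list is verbatim
that of `le_energyDensity2D_of_forall_torusLimit`.)  Notion provenance: ground-state-class relaxation node with a
general objective, [cite: KullEtAl2024, §II.B]; stability rows [cite: BratteliRobinsonII1997, Prop. 5.3.25]. -/
def GSObsNode (t U n : ℝ) (W : Finset (Site 2)) (O : FermionOp W) (lo : ℝ) : Prop :=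
  ∀ (ω : InfVolFermionState 2) (ψ : ∀ L, Fock (Orb (FermionTorus 2 L))) (Ls : ℕ → ℕ),
    Tendsto Ls atTop atTop → ω.IsTorusLimitOf ψ Ls → ω.IsTranslationInvariant → ω.IsEven →
    (∀ j, star (ψ (Ls j)) ⬝ᵥ ψ (Ls j) = 1) →
    (∀ j, IsGroundStateInSector (hubbardTorus 2 (Ls j) t U) (rectN n (Ls j)) 0 (ψ (Ls j))) →
    ω.density = n →
    (∀ σ : Fin 2, ω.expect {0} (nAt 0 (Finset.mem_singleton_self 0) σ) = (((n / 2 : ℝ)) : ℂ)) →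
    lo ≤ (ω.expect W O).re

/-- `H ∈ 𝔄_W` is an energy observable: its expectation in every translation-invariant state is the Hubbard energy
density (e.g. op-07's window-averaged density `hAvg t U a b` on `rectWindow a b`, by `re_expect_hAvg`). [folklore] -/
def IsEnergyObs (t U : ℝ) (W : Finset (Site 2)) (H : FermionOp W) : Prop :=
  ∀ ω : InfVolFermionState 2, ω.IsTranslationInvariant → (ω.expect W H).re = ω.hubbardEnergyDensity t U

/-- `GSObsNode` is monotone in the slot: a smaller constant is also a valid floor. -/
theorem GSObsNode.mono {t U n : ℝ} {W : Finset (Site 2)} {O : FermionOp W} {lo lo' : ℝ}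
    (h : GSObsNode t U n W O lo) (hlo : lo' ≤ lo) : GSObsNode t U n W O lo' :=
  fun ω ψ Ls a b c d e f g i => hlo.trans (h ω ψ Ls a b c d e f g i)

/-- Additivity of the node in the observable. -/
theorem GSObsNode.add {t U n : ℝ} {W : Finset (Site 2)} {O₁ O₂ : FermionOp W} {lo₁ lo₂ : ℝ}
    (h₁ : GSObsNode t U n W O₁ lo₁) (h₂ : GSObsNode t U n W O₂ lo₂) :
    GSObsNode t U n W (O₁ + O₂) (lo₁ + lo₂) := by
  intro ω ψ Ls a b c d e f g i
  have k₁ := h₁ ω ψ Ls a b c d e f g i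
  have k₂ := h₂ ω ψ Ls a b c d e f g i
  rw [map_add, Complex.add_re]
  exact add_le_add k₁ k₂

/-- The node for an energy observable is a lower bound on the thermodynamic-limit energy density. -/
theorem GSObsNode.le_energyDensity2D {t U n : ℝ} (hU : 0 ≤ U) (hn0 : 0 ≤ n) (hn2 : n < 2)
    {W : Finset (Site 2)} {H : FermionOp W} (hH : IsEnergyObs t U W H) {lo : ℝ}
    (h : GSObsNode t U n W H lo) : lo ≤ energyDensity2D t U n := by
  refine le_energyDensity2D_of_forall_torusLimit t hU hn0 hn2 fun ω ψ Ls hLs hω hti hev h1 hgs hd hspin => ?_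
  rw [← hH ω hti]
  exact h ω ψ Ls hLs hω hti hev h1 hgs hd hspin

/-- **SPLIT GLUING (M7).** A podium leg for `H - O` with certified value `v` and a window leg for `O` with certified
value `ℓ` give `v + ℓ ≤ e₀(t, U, n)` — for ANY choice of the transferred observable `O` (= `Σ β_v · v̂`). -/
theorem energyDensity2D_ge_of_split {t U n : ℝ} (hU : 0 ≤ U) (hn0 : 0 ≤ n) (hn2 : n < 2)
    {W : Finset (Site 2)} {H O : FermionOp W} (hH : IsEnergyObs t U W H) {v ℓ : ℝ}
    (hP : GSObsNode t U n W (H - O) v) (hW : GSObsNode t U n W O ℓ) :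
    v + ℓ ≤ energyDensity2D t U n := by
  have key := hP.add hW
  rw [sub_add_cancel] at key
  exact key.le_energyDensity2D hU hn0 hn2 hH

/-- Several windows at once: transferring `O₁, …, O_k` (here two) to separate window legs. -/
theorem energyDensity2D_ge_of_split₂ {t U n : ℝ} (hU : 0 ≤ U) (hn0 : 0 ≤ n) (hn2 : n < 2)
    {W : Finset (Site 2)} {H O₁ O₂ : FermionOp W} (hH : IsEnergyObs t U W H) {v ℓ₁ ℓ₂ : ℝ}
    (hP : GSObsNode t U n W (H - O₁ - O₂) v) (h₁ : GSObsNode t U n W O₁ ℓ₁) (h₂ : GSObsNode t U n W O₂ ℓ₂) :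
    v + ℓ₁ + ℓ₂ ≤ energyDensity2D t U n := by
  have key := (hP.add h₂).add h₁
  rw [sub_add_cancel, sub_add_cancel] at key
  have := key.le_energyDensity2D hU hn0 hn2 hH
  linarith


/-! ## R2 — window nodes with affine-`D₄` ("iso") rows AND ground-state stability rows (statement only)

`WindowLTI'`/`WindowD4` re-type op-07's `WindowLTI` (translations) and add Han's point-group identifications
(`PolySite.d4Emb`, tree `HubbardWindowCertificateD4`); `stabilityObs'` re-types op-07's `stabilityObs`.  `GSWindowNode` is
op-07's `LTIRectGSNode` for a general window `W`, a general objective `H` and WITH the `D₄` rows; `GSWindowNodeSound` is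
the residual soundness statement R2 (to be proved by the Lean pen; NOT proved here). -/

/-- Translation rows (op-07's `WindowLTI`, re-typed for a general window): the LTI row family of the
window-marginal relaxation. [cite: KullEtAl2024, §II.B] -/
def WindowLTI' {W : Finset (Site 2)} (ρ : FermionOp W) : Prop :=
  ∀ (S : Finset (Site 2)) (v : Site 2) (hS : S ⊆ W) (hSv : shiftSet v S ⊆ W) (A : FermionOp S),
    (ρ * fermionEmbed (PolySite.incl hS) A).trace =
      (ρ * fermionEmbed ((PolySite.shiftEmb v S).trans (PolySite.incl hSv)) A).trace

/-- Affine-`D₄` rows ("iso rows"): the window state identifies every sub-pattern `S ⊆ W` with each of its affine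
point-group images `γ S + w ⊆ W` (`γ ∈ D₄`, `w ∈ ℤ²`; `γ = 1` are the translation rows). [cite: Han2020Bootstrap, §3] -/
def WindowD4 {W : Finset (Site 2)} (ρ : FermionOp W) : Prop :=
  ∀ (γ : DihedralGroup 4) (w : Site 2) (S : Finset (Site 2)) (hS : S ⊆ W) (hS' : d4ShiftSet γ w S ⊆ W)
    (A : FermionOp S),
    (ρ * fermionEmbed (PolySite.incl hS) A).trace =
      (ρ * fermionEmbed (PolySite.incl hS') (fermionEmbed (PolySite.d4Emb γ w S) A)).trace

/-- op-07's Bratteli–Robinson stability observable `Ãᴴ [H_{Λ⁺}, Ã]` on `Λ⁺ = thicken Λ 1` (re-typed).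
[cite: BratteliRobinsonII1997, Prop. 5.3.25] -/
def stabilityObs' (t U : ℝ) (Λ : Finset (Site 2)) (A : FermionOp Λ) : FermionOp (thicken Λ 1) :=
  (fermionEmbed (PolySite.incl (subset_thicken Λ 1)) A)ᴴ *
    ((hubbardFermionInteraction 2 t U).localHamiltonian (thicken Λ 1) *
        fermionEmbed (PolySite.incl (subset_thicken Λ 1)) A -
      fermionEmbed (PolySite.incl (subset_thicken Λ 1)) A *
        (hubbardFermionInteraction 2 t U).localHamiltonian (thicken Λ 1))

/-- **The NGW window node of DESIGN.md H0 with ALL its row families**: positivity, unit trace, translation rows,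
affine-`D₄` rows, density row, `S^z = 0` rows, ground-state stability rows, objective `H`.  Row families:
[cite: KullEtAl2024, §II.B] [cite: Han2020Bootstrap, §3] [cite: BratteliRobinsonII1997, Prop. 5.3.25] -/
def GSWindowNode (t U n : ℝ) (W : Finset (Site 2)) (H : FermionOp W) (lo : ℝ) : Prop :=
  ∀ ρ : FermionOp W, ρ.PosSemidef → ρ.trace = 1 → WindowLTI' ρ → WindowD4 ρ →
    ((ρ * totalNumber).trace).re = (W.card : ℝ) * n →
    (∀ σ : Fin 2, ((ρ * ∑ y : PolySite W, numberOp y σ).trace).re = (W.card : ℝ) * (n / 2)) →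
    (∀ (Λ : Finset (Site 2)) (hΛ : thicken Λ 1 ⊆ W) (A : FermionOp Λ),
        Commute A totalNumber → Commute A HubbardWave0.spinZ →
        0 ≤ (ρ * fermionEmbed (PolySite.incl hΛ) (stabilityObs' t U Λ A)).trace) →
    lo ≤ ((ρ * H).trace).re

/-- `GSWindowNode` is monotone in the slot: a smaller constant is also a valid floor. -/
theorem GSWindowNode.mono {t U n : ℝ} {W : Finset (Site 2)} {H : FermionOp W} {lo lo' : ℝ}
    (h : GSWindowNode t U n W H lo) (hlo : lo' ≤ lo) : GSWindowNode t U n W H lo' :=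
  fun ρ h1 h2 h3 h4 h5 h6 h7 => hlo.trans (h ρ h1 h2 h3 h4 h5 h6 h7)

/-- **R2 (residual, to be proved): soundness of the full NGW window node.**  For `U ≥ 0`, `0 ≤ n < 2` and an energy
observable `H` on `W`, a certified `GSWindowNode t U n W H lo` is a certified `lo ≤ e₀(t,U,n)`.  Proof route (not
formalised): the affine-`D₄` average of the torus-limit ground-state-class witnesses `ω ∘ g` is feasible for every
(linear) row and has objective value `e₀`; needs the class invariance `ω ↦ ω ∘ (x ↦ γ x + w)` of
`le_energyDensity2D_of_forall_torusLimit`'s hypothesis class (torus side: `fockD4`, `d4Affine_mul_hubbardTorus`,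
`d4Affine_mulVec_mem_szSector`, tree `HubbardWindowCertificateD4`).
STATUS: OPEN obligation node minted inside the programme (hubbard-alg L2, R2; kill date 2026-08-27) — tagged
`@[conjecture]` = provable/refutable BY NAME, NOT a vendored or published fact; consumed only as a hypothesis below. -/
@[conjecture] def GSWindowNodeSound (t U n : ℝ) (W : Finset (Site 2)) (H : FermionOp W) : Prop :=
  IsEnergyObs t U W H → ∀ lo : ℝ, GSWindowNode t U n W H lo → lo ≤ energyDensity2D t U n

/-- What R2 buys, stated as an implication that IS proved here: soundness of the node makes every certified node value
(with any general objective split off, cf. `energyDensity2D_ge_of_split`) a TL bound. -/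
theorem le_energyDensity2D_of_sound {t U n : ℝ} {W : Finset (Site 2)} {H : FermionOp W}
    (hs : GSWindowNodeSound t U n W H) (hH : IsEnergyObs t U W H) {lo : ℝ} (h : GSWindowNode t U n W H lo) :
    lo ≤ energyDensity2D t U n :=
  hs hH lo h


/-! ## M3 cell by name (hubbard-alg target point `t = 1, U = 8, n = 7/8, t' = 0`), conditional on R2 -/

/-- A certified full-window node value `lo : ℚ` at the canonical point is an M3 LOWER energy row
`M3EnergyLowerRow 0 lo` — GIVEN the residual soundness statement `GSWindowNodeSound` (R2, open). -/
theorem m3EnergyLowerRow_of_sound {W : Finset (Site 2)} {H : FermionOp W}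
    (hs : GSWindowNodeSound 1 8 (7 / 8) W H) (hH : IsEnergyObs 1 8 W H) {lo : ℚ}
    (h : GSWindowNode 1 8 (7 / 8) W H lo) : M3EnergyLowerRow 0 lo := by
  rw [M3EnergyLowerRow_zero_iff]
  exact hs hH lo h

/-- The split-gluing edge lands in the M3 cell: a podium leg `v` for `H - O` and a window leg `ℓ` for `O`
(both torus-limit ground-state-class nodes, PROVED sound) give `M3EnergyLowerRow 0 (v + ℓ)`. -/
theorem m3EnergyLowerRow_of_split {W : Finset (Site 2)} {H O : FermionOp W} (hH : IsEnergyObs 1 8 W H)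
    {v ℓ : ℚ} (hP : GSObsNode 1 8 (7 / 8) W (H - O) v) (hW : GSObsNode 1 8 (7 / 8) W O ℓ) :
    M3EnergyLowerRow 0 (v + ℓ) := by
  rw [M3EnergyLowerRow_zero_iff]
  push_cast
  exact energyDensity2D_ge_of_split (by norm_num) (by norm_num) (by norm_num) hH hP hW

end Summit.Ventures.CertifiedManyBodySolver.HubbardAlg.GSWindowNodeD4

end
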